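import Mathlib
import HarnessLib
import Summits.ResolutionOfSingularities.ResolutionOfSingularities.Theorems.WildQuotientsWildQuotientResolutionS1aKillShift
import Summits.ResolutionOfSingularities.ResolutionOfSingularities.Theorems.WildQuotientsWildQuotientResolutionS1aKillCriterion

/-!
# S1a — KC5_δ: the POWER-CHAIN TYPE WITH SHIFT — a kill certificate `β s^δ` whenever a POWER of each centre generator is, to leading order, a unit times an increment

[OURS · L1 W4.5c · lead-1 g14; KC5 (`…S1aKillChains` ✓p701348) generalised along KC3_δ (`…S1aKillShift` ✓p639579: «census trA needs δ = 3», plan-1 ASSIGNMENT v10.25 (3))]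
— NOT statements of the manuscript; counted 0; AI-level work, weaker than expert review. Crux stmt-ResolutionOfSingularities-17941 `CyclicQuotientFourfolds`, line
`s1a-logminvertex` v13, instance programme (`stub_reachLowerInFX`). Route-independent; pure algebra on `R^w = B[s, fᵢ t^{wᵢ}]`.

POWER-CHAIN DATA at the generator `fᵢ` (weight `wᵢ > 0`), for a shift `δ` and boundary `β`: an exponent `mᵢ ≥ 1` with `δ ≤ mᵢ wᵢ`, an element
`uᵢ ∈ 𝒥_{mᵢwᵢ − δ}` and a unit `hᵢ` with `σ uᵢ − uᵢ − β hᵢ fᵢ^{mᵢ} ∈ β 𝒥_{mᵢwᵢ + 1}`. Then `σ_R(uᵢ tⁿ) − uᵢ tⁿ = β s^δ (hᵢ (fᵢʼ)^{mᵢ} + s·(…))`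
(`sigmaR_sub_eq_of_admissible_shift`), so `(fᵢʼ)^{mᵢ} ∈ (augIdeal σ_R : β s^δ) ⊔ (s)` and hence `𝔳^N ≤ (augIdeal σ_R : β s^δ) ⊔ (s)` for some `N` — hypothesis (i)_δ
of KC3_δ. INHABITANTS (every one a ONE-SHOT ROOT KILL, X-CERT's depth ≥ 2 for them being an artefact of the engine's `wmax = 2, δ ≤ 1`): trA (`x₁ ↦ x₁+x₀²,
x₂ ↦ x₂+x₀³, x₃ ↦ x₃+x₂`; centre (x₀:2, x₂:3), δ = 3, β = 1: `x₀³ = σx₂ − x₂` (m = 3, u = x₂ ∈ 𝒥₃), `x₂ = σx₃ − x₃` (m = 1, u = x₃ ∈ 𝒥₀)); k2a / a1c2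
(`x₁ ↦ x₁+x₀, x₃ ↦ x₃+x₁²+x₀x₁`; centre (x₀:3, x₁:1), δ = 2: `x₀ = σx₁ − x₁`, `x₁² ≡ σx₃ − x₃ mod 𝒥₃`); d4c3 (`x₃ ↦ x₃+z³`, `z = x₁ − x₂` fixed; centre
(x₀:3, z:1), δ = 3: `z³ = σx₃ − x₃`) — see `…S1aTriangularShiftKillsIn`.
* ★★ `irrelevant_of_powerChains_shift` — (i)_δ of KC3_δ from power-chain data at every generator;
* ★★ `cobordantKillCert_of_powerChains_shift` — KC3_δ ∘ KC5_δ: (a′)_δ ∧ (ii) ∧ power chains ⇒ the cobordant kill certificate `β s^δ`.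
-/

set_option linter.dupNamespace false

noncomputable section

open Literature.AlgebraicGeometry.Resolution
open scoped LaurentPolynomial
open LaurentPolynomial
open Summit.ResolutionOfSingularities.ResolutionOfSingularities.Theorems.WildQuotientResolution.S1.CoarseChart

namespace Summit.ResolutionOfSingularities.ResolutionOfSingularities.Theorems.WildQuotientResolution.S1.KillCert

universe u

section PowerChains

variable {B : Type u} [CommRing B] {c : ℕ} (f : Fin c → B) (w : Fin c → ℕ) (σ : B ≃+* B)
  (hσJ : ∀ n : ℕ, ((weightedFiltration f w).ideal n).map (σ : B →+* B) ≤ (weightedFiltration f w).ideal n)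
  {p : ℕ} (hp : 0 < p) (hσp : ∀ x : B, (⇑σ)^[p] x = x) (δ : ℕ)

/-- One power chain puts a POWER of the generator `fᵢʼ` into `(augIdeal σ_R : β s^δ) ⊔ (s)`. [OURS · L1 W4.5c · KC5_δ] -/
theorem u'_pow_mem_of_powerChain_shift (β : B) (i : Fin c) {m : ℕ} (hm : δ ≤ m * w i) {u h : B} (hh : IsUnit h)
    (hu : u ∈ (weightedFiltration f w).ideal (m * w i - δ))
    (hrow : σ u - u - β * h * f i ^ m ∈ Ideal.span {β} * (weightedFiltration f w).ideal (m * w i + 1)) :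
    cobordantAlgebra.u' f w i ^ m ∈
      (augmentationIdeal (sigmaR σ f w hσJ hp hσp)).colon
          (Ideal.span {algebraMap B (↥(cobordantAlgebra f w)) β * cobordantAlgebra.s f w ^ δ}) ⊔
        cobordantAlgebra.excIdeal f w := by
  obtain ⟨j, hj, ej⟩ := Ideal.mem_span_singleton_mul.mp hrow
  -- `m wᵢ = n + δ`
  obtain ⟨n, hn⟩ : ∃ n : ℕ, m * w i = n + δ := ⟨m * w i - δ, (Nat.sub_add_cancel hm).symm⟩
  have hu' : u ∈ (weightedFiltration f w).ideal n := by rw [hn, Nat.add_sub_cancel] at hu; exact hu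
  have hpow : ∀ l : ℕ, f i ^ l ∈ (weightedFiltration f w).ideal (l * w i) := by
    intro l
    induction l with
    | zero => rw [pow_zero, zero_mul, (weightedFiltration f w).ideal_zero]; trivial
    | succ l ih =>
      have := (weightedFiltration f w).mul_le _ _ (Ideal.mul_mem_mul ih (mem_weightedFiltration_ideal f w i))
      rwa [← pow_succ, show l * w i + w i = (l + 1) * w i by ring] at this
  have hfm : f i ^ m ∈ (weightedFiltration f w).ideal (m * w i) := hpow m
  have hJ : h * f i ^ m + j ∈ (weightedFiltration f w).ideal (n + δ) := by
    rw [← hn]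
    exact add_mem (Ideal.mul_mem_left _ _ hfm) ((weightedFiltration f w).antitone (Nat.le_succ _) hj)
  have hyj : σ u - u = β * (h * f i ^ m + j) := by
    rw [mul_add, ej]
    ring
  let z : ↥(cobordantAlgebra f w) := ⟨_, C_mul_T_mem_cobordantAlgebra f w hu'⟩
  let zj : ↥(cobordantAlgebra f w) := ⟨_, C_mul_T_mem_cobordantAlgebra f w hj⟩
  have hzj : ((zj : ↥(cobordantAlgebra f w)) : B[T;T⁻¹]) = C j * T ((m * w i + 1 : ℕ) : ℤ) := rfl
  have hum : (((cobordantAlgebra.u' f w i ^ m : ↥(cobordantAlgebra f w))) : B[T;T⁻¹]) = C (f i ^ m) * T ((m * w i : ℕ) : ℤ) := by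
    rw [SubmonoidClass.coe_pow, cobordantAlgebra.coe_u', mul_pow, ← map_pow, T_pow, Nat.cast_mul]
  have hz' : ((algebraMap B (↥(cobordantAlgebra f w)) h * cobordantAlgebra.u' f w i ^ m + cobordantAlgebra.s f w * zj :
      ↥(cobordantAlgebra f w)) : B[T;T⁻¹]) = C (h * f i ^ m + j) * T ((n + δ : ℕ) : ℤ) := by
    rw [AddMemClass.coe_add, MulMemClass.coe_mul, MulMemClass.coe_mul, cobordantAlgebra.coe_algebraMap, hum, cobordantAlgebra.coe_s, hzj, ← hn,
      map_add, map_mul, add_mul]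
    congr 1
    · rw [mul_assoc]
    · rw [mul_left_comm, ← T_add]
      congr 2
      push_cast
      ring
  have key : (algebraMap B (↥(cobordantAlgebra f w)) h * cobordantAlgebra.u' f w i ^ m + cobordantAlgebra.s f w * zj) *
      (algebraMap B (↥(cobordantAlgebra f w)) β * cobordantAlgebra.s f w ^ δ) = sigmaR σ f w hσJ hp hσp z - z := by
    rw [mul_comm, sigmaR_sub_eq_of_admissible_shift f w σ hσJ hp hσp δ β hyj z _ rfl hz']
  refine mem_colon_sup_excIdeal_of_unit f w (hh.map (algebraMap B (↥(cobordantAlgebra f w)))) (z := zj) ?_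
  rw [key]
  exact sub_mem_augmentationIdeal _ _

/-- ★★ **KC5_δ — THE POWER-CHAIN TYPE WITH SHIFT.** Power-chain data at every generator (exponent `mᵢ ≥ 1` with `δ ≤ mᵢwᵢ`, `uᵢ ∈ 𝒥_{mᵢwᵢ−δ}`, unit `hᵢ`,
`σ uᵢ − uᵢ − β hᵢ fᵢ^{mᵢ} ∈ β 𝒥_{mᵢwᵢ+1}`) give hypothesis (i)_δ of KC3_δ: `𝔳^N ≤ (augIdeal σ_R : β s^δ) ⊔ (s)` for some `N`.
[OURS · L1 W4.5c · KC5_δ; NOT a statement of the manuscript] -/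
theorem irrelevant_of_powerChains_shift (β : B)
    (hchain : ∀ i, ∃ (m : ℕ) (u h : B), 0 < m ∧ δ ≤ m * w i ∧ IsUnit h ∧ u ∈ (weightedFiltration f w).ideal (m * w i - δ) ∧
      σ u - u - β * h * f i ^ m ∈ Ideal.span {β} * (weightedFiltration f w).ideal (m * w i + 1)) :
    ∃ N : ℕ, cobordantAlgebra.vertexIdeal f w ^ N ≤
      (augmentationIdeal (sigmaR σ f w hσJ hp hσp)).colon
          (Ideal.span {algebraMap B (↥(cobordantAlgebra f w)) β * cobordantAlgebra.s f w ^ δ}) ⊔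
        cobordantAlgebra.excIdeal f w := by
  refine Ideal.exists_pow_le_of_le_radical_of_fg ?_ (Submodule.fg_span (Set.finite_range _))
  rw [cobordantAlgebra.vertexIdeal, Ideal.span_le]
  rintro _ ⟨i, rfl⟩
  obtain ⟨m, u, h, -, hm, hh, hu, hrow⟩ := hchain i
  exact ⟨m, u'_pow_mem_of_powerChain_shift f w σ hσJ hp hσp δ β i hm hh hu hrow⟩

/-- ★★ **KC3_δ ∘ KC5_δ: the power-chain type kills.** Boundary-admissibility (a′)_δ (`y ∈ 𝒥ₙ ⇒ σy − y ∈ β𝒥ₙ₊δ`), isolation (ii) and power-chain data at every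
centre generator give the cobordant kill certificate `β s^δ` — hence (KC1) the augmentation ideal of `σʼ` is `(β s^δ)` on EVERY σ-fixed chart of the weighted
cobordant blow-up of `(f, w)`. [OURS · L1 W4.5c · KC3_δ∘KC5_δ; NOT a statement of the manuscript] -/
theorem cobordantKillCert_of_powerChains_shift (β : B)
    (hadm : ∀ (n : ℕ) (y : B), y ∈ (weightedFiltration f w).ideal n →
      σ y - y ∈ Ideal.span {β} * (weightedFiltration f w).ideal (n + δ))
    (hiso : ∃ N : ℕ, Ideal.span (Set.range f) ^ N ≤ (augmentationIdeal σ).colon (Ideal.span {β}))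
    (hchain : ∀ i, ∃ (m : ℕ) (u h : B), 0 < m ∧ δ ≤ m * w i ∧ IsUnit h ∧ u ∈ (weightedFiltration f w).ideal (m * w i - δ) ∧
      σ u - u - β * h * f i ^ m ∈ Ideal.span {β} * (weightedFiltration f w).ideal (m * w i + 1)) :
    CobordantKillCert f w σ hσJ hp hσp (algebraMap B (↥(cobordantAlgebra f w)) β * cobordantAlgebra.s f w ^ δ) :=
  cobordantKillCert_of_admissible_of_irrelevant_shift f w σ hσJ hp hσp δ β hadm hiso
    (irrelevant_of_powerChains_shift f w σ hσJ hp hσp δ β hchain)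

end PowerChains

end Summit.ResolutionOfSingularities.ResolutionOfSingularities.Theorems.WildQuotientResolution.S1.KillCert

end
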